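import Summits.BirchSwinnertonDyer.BirchSwinnertonDyer.Theorems.EdixhovenFibreFiveSevenStarredOptimalManinUnitFiveSevenHcorTwoPow
import Summits.BirchSwinnertonDyer.BirchSwinnertonDyer.Theses.EisensteinDepletionAtTwo
import Literature.NumberTheory.Automorphic.UnboundedDenominatorsOfCor453
import HarnessLib

set_option autoImplicit false
-- the sub-problem namespace `Summit.BirchSwinnertonDyer.BirchSwinnertonDyer` duplicates a component by design (D-0017)
set_option linter.dupNamespace false

/-!
# Route EisensteinDepletionAtTwo, support item `StarPrintUBD` (stmt-BirchSwinnertonDyer-23785), closed by name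

`StarPrintUBD` is VERBATIM the Literature named fact `CalegariDimitrovTang2025_unboundedDenominators` — the Unbounded
Denominators theorem, holomorphic-at-the-cusps integral-weight case [CalegariDimitrovTang2025, Thm. 1.0.1] — the second
published input of line `star`.  That fact is a tree theorem since line `cdt_thm1` of crux K★
(stmt-BirchSwinnertonDyer-22226, cell bsd-wall): CDT Cor. 4.5.3 in invariant form, proved for all levels as abstract group
theory of `SL₂(ℤ)` (`HcorTwoPow.stub_hcor_invariant_all`), composed with the reduction `of_cor453_invariant` (Ihara's
amalgam + CSP, Prop. 3.0.1, (4.3.3), rationality).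

This file closes the item BY NAME with that term, imported from the two ROUTE-INDEPENDENT modules (neither imports a
route file), so that the closer's import cone contains only this route's own file; the tree's
`calegariDimitrovTang2025_unboundedDenominators_holds` (p826028) is the same term in a module that sits in other routes'
cones.

HONEST STATUS.  A support item only: nothing else of line `star` is claimed; BSD is not proved by this; the statement audit
of the vendored CDT statement (`qExpansion`, `strictPeriods`, `IsCongruenceSubgroup`) is pending.
[cite: CalegariDimitrovTang2025, Thm. 1.0.1 and Cor. 4.5.3]
-/

namespace Summit.BirchSwinnertonDyer.BirchSwinnertonDyer.Theorems

open Literature.NumberTheory.Automorphic Literature.NumberTheory.Automorphic.UnboundedDenominators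

/-- **Support item `StarPrintUBD` (stmt-BirchSwinnertonDyer-23785), proved by name**: the item is the CDT statement
verbatim; the proof term is Cor. 4.5.3 in invariant form for all levels (`HcorTwoPow.stub_hcor_invariant_all`) fed to
`of_cor453_invariant` — definitionally the tree's `calegariDimitrovTang2025_unboundedDenominators_holds`, written from
modules that import no route file.  BSD is NOT proved by this. [cite: CalegariDimitrovTang2025, Thm. 1.0.1 and Cor. 4.5.3] -/
theorem EisensteinDepletionAtTwo.StarPrintUBD_proof :
    Summit.BirchSwinnertonDyer.BirchSwinnertonDyer.Theses.EisensteinDepletionAtTwo.StarPrintUBD :=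
  CalegariDimitrovTang2025_unboundedDenominators.of_cor453_invariant HcorTwoPow.stub_hcor_invariant_all

end Summit.BirchSwinnertonDyer.BirchSwinnertonDyer.Theorems
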